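import Summits.QuantumFields.YangMills.Theorems.BalabanUVNodesN07HalvingBudgetConstants
import HarnessLib

/-!
# BalabanUVNodes ∕ N07 — [15] (162)∕(163)∕(166) WITH THE S3 CONSTRAINTS FOLDED INTO THE ORDER OF CHOICES: the collar `ρ` a MULTIPLE of a given big block (stub 2′'s `ρ₀`, the
# head's `L·M_h`), above any floor, beating TWO exponentially small coefficients; then `B₃ > 0`; then the class ceiling `a₀` BELOW A GIVEN POSITIVE CAP (`a0OfP F N Mc ρ B₁ c₁` of the
# (152) door); and the two guard constants `(c, c₀)` of the V20-G text after `ρ` — pure arithmetic, the S3 side of the S6 head's knit `…N07SplitClauseHeadKnit`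

Cell `pub-ymgap`, width seat `pub-ymgap-dag-n07-w3` generation 7 (sub-target S3), CLAIM-2 ∕ INTENT-2 (cell bus 2026-08-28).  `--kind proof --supports stmt-QuantumFields-27364 --as helper`
(K1⁹; count-neutral; def-free; imports dag-n07-w4's `…N07HalvingBudgetConstants` (p619892) + HarnessLib only).  [15] = [Balaban1985Variational]; [6] = [Balaban1985RegularSpaces].

WHY.  dag-n07-w4's `N07HalvingBudgetConstants.exists_halvingBudget` fixes print's ORDER of choices — (163) the collar `ρ` first, (162) `B₃`, (166) the ceiling `a₀` — for arbitrary
nonnegative coefficient functions of `ρ`.  The S3 door of this seat (`…N07DatumGauge152Guarded.datumGauge152_REfiner153_of_prop6P_guarded(_of_dvd)`, p631846), consumed per datum by the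
head's knit `…N07SplitClauseHeadKnit` (CLAIM-5), adds FOUR arithmetic constraints to that order: (a) [6] Prop. 6 is held at stub 2′'s big block `ρ₀`, so the knit's collar must be a
MULTIPLE of `ρ₀` (`_of_dvd`; and of the head's `L·M_h`: take `M₁ := ρ₀·L·M_h`); (b) the ceiling must sit below the door's POSITIVE cap `a₀ ≤ a0OfP F N Mc ρ B₁ c₁`, which depends on `ρ`
(so it is read AFTER `ρ`, like `C(ρ)`, `Q(ρ)`, `κ(ρ) = b9OfP F Mc ρ B₁`); (c) the guard's floor letter `c ≥ (11·4 + 4ρ + Mc + 3)·L` and (d) its level letter `c₀` with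
`Mc + 44 + 6ρ ≤ 2L^{c₀}`, the head's LOCATED-LEVEL-CAP `F.m ≤ c₀` and `a′ + 3 ≤ c₀` — both chosen after `ρ`.  Besides, the knit carries TWO exponentially small far-site coefficients
(the token's `16θ ≤ 1` and the `HB` door's `8C_HB_He^{−δ_Hρ} ≤ θ_H`).  THIS FILE re-assembles the order of choices with (a)–(d) and two exponentials, for ARBITRARY inputs.

WHAT IS PROVED (sorry-free; no definition; axioms standard; freshman arithmetic only).
* §1 `exists_threshold_mul_exp_neg_le` (threshold form of the head's §1: `∃ N, ∀ ρ ≥ N, c·e^{−δ₁ρ} ≤ η`, ANY real `c`), `exists_dvd_ge` (a multiple of `M₁ ≥ 1` above any floor).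
* §2 `exists_a0_budget_le` (the head's ceiling with a positive CAP: `0 < a₀ ≤ a0max`), `exists_B3_budget_pos` (`0 < B₃`, `2L² ≤ B₃`, `4C ≤ B₃`).
* §3 `exists_guardConstants` (naturals: `∃ c c₀`, `(11·4 + 4ρ + Mc + 3)·L ≤ c`, `Mc + 11·4 + 6ρ ≤ 2L^{c₀}`, `m ≤ c₀`, `a′ + 3 ≤ c₀`; `L ≥ 2`).
* §4 ★★ `exists_halvingBudget_S3`: for `M₁ ≥ 1`, any floor `ρfl`, two rates `δ₁, δ₂ > 0` with prefactors `c₁, c₂` and targets `η₁, η₂ > 0`, and ARBITRARY `Cof Qof κof : ℕ → ℝ` (`Qof, κof ≥ 0`)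
  and a POSITIVE cap `a0of : ℕ → ℝ`: `∃ ρ, M₁ ∣ ρ ∧ ρfl ≤ ρ ∧ c₁e^{−δ₁ρ} ≤ η₁ ∧ c₂e^{−δ₂ρ} ≤ η₂ ∧ ∃ B₃ a₀, 0 < B₃ ∧ 2L² ≤ B₃ ∧ 4·Cof ρ ≤ B₃ ∧ 0 < a₀ ∧ a₀ ≤ a0of ρ ∧ 2a₀ ≤ 1 ∧
  (16·Qof ρ + 1024·κof ρ²)·a₀ ≤ 1 ∧ 32·κof ρ·a₀ ≤ 1`; ★ `exists_halvingBudget_S3_guard` (the same ∧ §3's `(c, c₀)` at that `ρ`, for naturals `L m a′ Mc`).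
HONEST SCOPE.  Count-neutral arithmetic on the ORDER of choices only; NO estimate of Bałaban's; the coefficient functions, caps and rates are ARBITRARY inputs (at the knit: `κof ρ := b9OfP F Mc ρ B₁`,
`a0of ρ := a0OfP F N Mc ρ B₁ c₁ > 0` by `a0OfP_pos`, `M₁ := ρ₀·(F.L·M_h)`); tokens ∕ `stub_prop8StepCoP13` ∕ K0⁷ ∕ K1⁹ NOT closed; N07 NOT discharged; counts unmoved (the chair's tally is the only
count); one finite 𝕋⁴ programme at fixed ε — R4 closes the conditional finite-𝕋⁴ rung `BalabanLadder.UV` ONLY; the YM mass gap (Clay) is NOT proved by any of this; nothing continuum ∕ ℝ⁴ ∕ OS.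
No `def`, no `instance`, no `notation`, no `sorry`.

References: T. Bałaban, CMP **102** (1985) 277–309 [Balaban1985Variational] (162)–(163) pp.303–304, (166)–(167) p.304, p.304 lines 1–2; CMP **99** (1985) [Balaban1985RegularSpaces] p.98
(«M is a multiple of R₁M₁»); CMP **109** (1987) [Balaban1987RG1] (0.1) p.251.
-/

set_option autoImplicit false

namespace Summit.QuantumFields.YangMills.BalabanUVNodes.N07HalvingBudgetS3

open Summit.QuantumFields.YangMills.BalabanUVNodes.N07HalvingBudgetConstants (exists_nat_mul_exp_neg_le exists_a0_budget)

/-! ## §1  The collar: threshold form, and multiples of a big block above a floor -/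

/-- **THRESHOLD FORM OF (163)**: for `δ₁ > 0`, `η > 0` and ANY real `c` there is `N` such that EVERY `ρ ≥ N` has `c·e^{−δ₁ρ} ≤ η` (for `c ≤ 0` every `ρ`; for `c > 0` the head's
witness and monotonicity of `e^{−δ₁ρ}` in `ρ`). [cite: Balaban1985Variational, (163) p.304] -/
theorem exists_threshold_mul_exp_neg_le {δ₁ η : ℝ} (hδ₁ : 0 < δ₁) (hη : 0 < η) (c : ℝ) :
    ∃ N : ℕ, ∀ ρ : ℕ, N ≤ ρ → c * Real.exp (-(δ₁ * ρ)) ≤ η := by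
  obtain ⟨N, -, hN⟩ := exists_nat_mul_exp_neg_le hδ₁ hη c 0
  refine ⟨N, fun ρ hρ => ?_⟩
  by_cases hc : c ≤ 0
  · exact (mul_nonpos_of_nonpos_of_nonneg hc (Real.exp_nonneg _)).trans hη.le
  · have hc' : 0 ≤ c := le_of_not_ge hc
    have hmono : Real.exp (-(δ₁ * ρ)) ≤ Real.exp (-(δ₁ * N)) := by
      apply Real.exp_le_exp.mpr
      have : (N : ℝ) ≤ ρ := by exact_mod_cast hρ
      nlinarith
    exact (mul_le_mul_of_nonneg_left hmono hc').trans hN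

/-- **A MULTIPLE OF THE BIG BLOCK ABOVE ANY FLOOR** ([6] p. 98 «M is a multiple of R₁M₁»; print's `ρ = R₁M₁` with `R₁` big): `M₁ ≥ 1` ⇒ `∃ ρ, M₁ ∣ ρ ∧ n ≤ ρ` (`ρ := M₁·n`).
[cite: Balaban1985RegularSpaces, p.98] -/
theorem exists_dvd_ge {M₁ : ℕ} (hM₁ : 1 ≤ M₁) (n : ℕ) : ∃ ρ : ℕ, M₁ ∣ ρ ∧ n ≤ ρ :=
  ⟨M₁ * n, Dvd.intro n rfl, Nat.le_mul_of_pos_left n hM₁⟩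

/-! ## §2  Then `B₃ > 0`, then the ceiling below a positive cap -/

/-- **(166) WITH A CAP**: for `Q, κ ≥ 0` and a cap `a0max > 0` there is `a₀` with `0 < a₀ ≤ a0max`, `2a₀ ≤ 1`, `(16Q + 1024κ²)·a₀ ≤ 1`, `32κ·a₀ ≤ 1` (the head's witness `min`'d with the
cap — every letter is an upper bound except positivity). The cap at the knit: the (152) door's `a0OfP F N Mc ρ B₁ c₁`. [cite: Balaban1985Variational, (166) p.304; Balaban1985RegularSpaces, Prop. 6 p.99] -/
theorem exists_a0_budget_le {Q κ a0max : ℝ} (hQ : 0 ≤ Q) (hκ : 0 ≤ κ) (ha : 0 < a0max) :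
    ∃ a₀ : ℝ, 0 < a₀ ∧ a₀ ≤ a0max ∧ 2 * a₀ ≤ 1 ∧ (16 * Q + 1024 * κ ^ 2) * a₀ ≤ 1 ∧ 32 * κ * a₀ ≤ 1 := by
  obtain ⟨a, ha0, h2, hQκ, h32⟩ := exists_a0_budget hQ hκ
  have hm : min a a0max ≤ a := min_le_left _ _
  have hQκ0 : 0 ≤ 16 * Q + 1024 * κ ^ 2 := by positivity
  refine ⟨min a a0max, lt_min ha0 ha, min_le_right _ _, ?_, ?_, ?_⟩
  · linarith
  · exact (mul_le_mul_of_nonneg_left hm hQκ0).trans hQκ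
  · exact (mul_le_mul_of_nonneg_left hm (by positivity)).trans h32

/-- **(162) WITH V19's FLOOR AND POSITIVITY**: `B₃ := max{2L², 4C, 1}` has `0 < B₃`, `2L² ≤ B₃`, `4C ≤ B₃` (the knit's `0 < B₃` for the radii's positivity `ε ≥ B₃δ > 0`).
[cite: Balaban1985Variational, (162) p.303] -/
theorem exists_B3_budget_pos (L C : ℝ) : ∃ B₃ : ℝ, 0 < B₃ ∧ 2 * L ^ 2 ≤ B₃ ∧ 4 * C ≤ B₃ :=
  ⟨max (max (2 * L ^ 2) (4 * C)) 1, lt_of_lt_of_le one_pos (le_max_right _ _), (le_max_left _ _).trans (le_max_left _ _),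
    (le_max_right _ _).trans (le_max_left _ _)⟩

/-! ## §3  The guard's two constants after `ρ` -/

/-- **THE V20-G GUARD CONSTANTS EXIST AFTER `ρ`**: for `L ≥ 2` and any `m a′ Mc ρ` there are `c c₀` with the (152) door's floor letter `(11·4 + 4ρ + Mc + 3)·L ≤ c`, its level letter
`Mc + 11·4 + 6ρ ≤ 2L^{c₀}`, the head's LOCATED-LEVEL-CAP `m ≤ c₀` and `a′ + 3 ≤ c₀` (`c :=` the floor itself, `c₀ := max{m, a′ + 3, X}` with `X := Mc + 44 + 6ρ ≤ 2^X ≤ 2L^X`).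
[cite: Balaban1985Variational, p.304 lines 1–2; Balaban1987RG1, (0.1) p.251] -/
theorem exists_guardConstants {L : ℕ} (hL : 2 ≤ L) (m a' Mc ρ : ℕ) :
    ∃ c c₀ : ℕ, (11 * 4 + 4 * ρ + Mc + 3) * L ≤ c ∧ Mc + 11 * 4 + 6 * ρ ≤ 2 * L ^ c₀ ∧ m ≤ c₀ ∧ a' + 3 ≤ c₀ := by
  set X : ℕ := Mc + 11 * 4 + 6 * ρ with hX
  refine ⟨(11 * 4 + 4 * ρ + Mc + 3) * L, max (max m (a' + 3)) X, le_rfl, ?_, (le_max_left _ _).trans (le_max_left _ _),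
    (le_max_right _ _).trans (le_max_left _ _)⟩
  have h1 : X ≤ 2 * L ^ X :=
    le_trans (Nat.lt_two_pow_self).le (le_trans (Nat.pow_le_pow_left hL X) (Nat.le_mul_of_pos_left _ two_pos))
  exact h1.trans (Nat.mul_le_mul_left 2 (Nat.pow_le_pow_right (by omega) (le_max_right _ _)))

/-! ## §4  ★★ The order of choices with the S3 constraints, assembled -/

/-- ★★ **THE CONSTANTS OF THE ONE-STEP IMPROVEMENT IN PRINT'S ORDER, WITH THE S3 CONSTRAINTS** — (163) the collar `ρ`: a MULTIPLE of the big block `M₁ ≥ 1` (stub 2′'s `ρ₀` and the head's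
`L·M_h` at once via `M₁ := ρ₀·L·M_h`), above any floor `ρfl` (`R·L·M_h`, `L`, …), making TWO far-site coefficients small (`c₁e^{−δ₁ρ} ≤ η₁`: the token's `16θ ≤ 1`; `c₂e^{−δ₂ρ} ≤ η₂`: the `HB`
door's (163)-row); then (162) `B₃ > 0` above `2L²` and `4·Cof ρ`; then (166) the ceiling `0 < a₀ ≤ a0of ρ` (the (152) door's cap, read AFTER `ρ`) with `2a₀ ≤ 1`, `(16·Qof ρ + 1024·κof ρ²)·a₀ ≤ 1`,
`32·κof ρ·a₀ ≤ 1` — for ARBITRARY coefficient functions (`Qof, κof ≥ 0`) and an arbitrary POSITIVE cap.  NO estimate: only the order of the choices.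
[cite: Balaban1985Variational, (162)–(163) pp.303–304, (166)–(167) p.304; Balaban1985RegularSpaces, p.98, Prop. 6 p.99] -/
theorem exists_halvingBudget_S3 {M₁ : ℕ} (hM₁ : 1 ≤ M₁) (ρfl : ℕ) {δ₁ δ₂ η₁ η₂ : ℝ} (hδ₁ : 0 < δ₁) (hδ₂ : 0 < δ₂) (hη₁ : 0 < η₁) (hη₂ : 0 < η₂) (c₁ c₂ L : ℝ)
    {Cof Qof κof a0of : ℕ → ℝ} (hQ : ∀ ρ, 0 ≤ Qof ρ) (hκ : ∀ ρ, 0 ≤ κof ρ) (ha : ∀ ρ, 0 < a0of ρ) :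
    ∃ ρ : ℕ, M₁ ∣ ρ ∧ ρfl ≤ ρ ∧ c₁ * Real.exp (-(δ₁ * ρ)) ≤ η₁ ∧ c₂ * Real.exp (-(δ₂ * ρ)) ≤ η₂ ∧
      ∃ B₃ a₀ : ℝ, 0 < B₃ ∧ 2 * L ^ 2 ≤ B₃ ∧ 4 * Cof ρ ≤ B₃ ∧
        0 < a₀ ∧ a₀ ≤ a0of ρ ∧ 2 * a₀ ≤ 1 ∧ (16 * Qof ρ + 1024 * κof ρ ^ 2) * a₀ ≤ 1 ∧ 32 * κof ρ * a₀ ≤ 1 := by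
  obtain ⟨N₁, hN₁⟩ := exists_threshold_mul_exp_neg_le hδ₁ hη₁ c₁
  obtain ⟨N₂, hN₂⟩ := exists_threshold_mul_exp_neg_le hδ₂ hη₂ c₂
  obtain ⟨ρ, hdvd, hge⟩ := exists_dvd_ge hM₁ (max ρfl (max N₁ N₂))
  obtain ⟨B₃, hB₃, hB₃L, hB₃C⟩ := exists_B3_budget_pos L (Cof ρ)
  obtain ⟨a₀, ha₀, hacap, ha2, haQ, haκ⟩ := exists_a0_budget_le (hQ ρ) (hκ ρ) (ha ρ)
  exact ⟨ρ, hdvd, (le_max_left _ _).trans hge, hN₁ ρ (((le_max_left _ _).trans (le_max_right _ _)).trans hge),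
    hN₂ ρ (((le_max_right _ _).trans (le_max_right _ _)).trans hge), B₃, a₀, hB₃, hB₃L, hB₃C, ha₀, hacap, ha2, haQ, haκ⟩

/-- ★ **THE SAME WITH THE GUARD's TWO CONSTANTS AT THAT COLLAR** (naturals `L ≥ 2`, `m`, `a′`, `Mc`; §3 after `ρ`): everything the head's knit `…N07SplitClauseHeadKnit` and the V20-G
stub-1 text ask of `(ρ, c, c₀, B₃, a₀)` on the S3 side, in print's order. [cite: Balaban1985Variational, (162)–(163) pp.303–304, (166) p.304, p.304 lines 1–2; Balaban1987RG1, (0.1) p.251] -/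
theorem exists_halvingBudget_S3_guard {L : ℕ} (hL : 2 ≤ L) (m a' Mc : ℕ) {M₁ : ℕ} (hM₁ : 1 ≤ M₁) (ρfl : ℕ) {δ₁ δ₂ η₁ η₂ : ℝ} (hδ₁ : 0 < δ₁) (hδ₂ : 0 < δ₂)
    (hη₁ : 0 < η₁) (hη₂ : 0 < η₂) (c₁ c₂ : ℝ) {Cof Qof κof a0of : ℕ → ℝ} (hQ : ∀ ρ, 0 ≤ Qof ρ) (hκ : ∀ ρ, 0 ≤ κof ρ) (ha : ∀ ρ, 0 < a0of ρ) :
    ∃ ρ : ℕ, M₁ ∣ ρ ∧ ρfl ≤ ρ ∧ c₁ * Real.exp (-(δ₁ * ρ)) ≤ η₁ ∧ c₂ * Real.exp (-(δ₂ * ρ)) ≤ η₂ ∧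
      (∃ c c₀ : ℕ, (11 * 4 + 4 * ρ + Mc + 3) * L ≤ c ∧ Mc + 11 * 4 + 6 * ρ ≤ 2 * L ^ c₀ ∧ m ≤ c₀ ∧ a' + 3 ≤ c₀) ∧
      ∃ B₃ a₀ : ℝ, 0 < B₃ ∧ 2 * (L : ℝ) ^ 2 ≤ B₃ ∧ 4 * Cof ρ ≤ B₃ ∧
        0 < a₀ ∧ a₀ ≤ a0of ρ ∧ 2 * a₀ ≤ 1 ∧ (16 * Qof ρ + 1024 * κof ρ ^ 2) * a₀ ≤ 1 ∧ 32 * κof ρ * a₀ ≤ 1 := by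
  obtain ⟨ρ, hdvd, hge, h₁, h₂, B₃, a₀, hrest⟩ := exists_halvingBudget_S3 hM₁ ρfl hδ₁ hδ₂ hη₁ hη₂ c₁ c₂ (L : ℝ) hQ hκ ha
  exact ⟨ρ, hdvd, hge, h₁, h₂, exists_guardConstants hL m a' Mc ρ, B₃, a₀, hrest⟩

end Summit.QuantumFields.YangMills.BalabanUVNodes.N07HalvingBudgetS3
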